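import Summits.BirchSwinnertonDyer.Rank1Residual.F1Sign2.RhombicSymbolCongruence
import Literature.NumberTheory.EllipticCurves.Selmer
import Literature.NumberTheory.EllipticCurves.Sha
import Literature.NumberTheory.EllipticCurves.MordellWeil
import Literature.NumberTheory.EllipticCurves.QuadraticTwist
import Literature.NumberTheory.EllipticCurves.Tamagawa
import HarnessLib

/-!
# Cell `bsd-f1-sign2` (`p = 2`, non-CM) — 2-descent / real-place lens (seat `-desc`) g2: the REAL-PLACE
# DESCENT SIGN `ε(E)` — typed candidates DESC-F `AdmissibleTwistSelmerShiftAtTwo`, F′, F⁵, F⁵′, DESC-C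
# `EggTwistLawAtTwo`, DESC-V `StrictShaPropagationAtTwo`, DESC-G/G⁰ `AdmissibleOddBranch{Floor,Exact}AtTwo`

TYPER FILING (seat `bsd-f1-sign2-ty`; HOME `run/shared/lean/pub/bsd-f1-sign2/`, CANDIDATES.md §2 rows
DESC-F…G⁰; -desc INBOX 2026-08-27T16:11:48Z «no filing until REF1 passes (then ONE file
F1Sign2/DescentSignAtTwo.lean)»): STATEMENTS ONLY — eight `Prop`s (T-A/T-A′/T-A⁵/T-A⁵′ support-grade,
IN PRINT as mathematics; T-C corollary; T-V theorem modulo T-A + T-A′; T-G/T-G⁰ conjecture-grade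
BSD₂-shadow, OPEN in print), their carriers (`NoRationalTwoTorsion`, `DescAdmissible`,
`twistSelmerTwoCard`, `selmerTwoCard`, `OnEgg`, `MeetsEgg`, `ShaTwoTrivial`, `oddBranchTameValue`,
`DescAdmissibleUnram`) as plain definitions with bodies, and two kernel-checked glue theorems; nothing
asserted, no named fact, PARTITION: none moved. Source: `HOME/MEMO-desc-data/Sketch-v2.1.lean` sha16
baf71db98ed43ff2 (planner bsd-f1-sign2-desc g2; `lean check` rc 0, 0 warnings, 0 sorries), re-filed
VERBATIM (namespace `…F1Sign2.DescG2` ↦ the cell's `…Rank1Residual.F1Sign2`; three cite tags given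
locators / an existing bib key: `Monsky1996, Thm. 1.5`, `KrizLi2019, Thm. 5.1; Zhai2016, Thm. 1.1`,
`CremonaMazur2000` for the planner's «Mazur 1999 visibility»). REFUTER PASS:
REF1-AUDIT-v1 §13 (g2 batch 7, 2026-08-27T16:55Z): **8/8 SURVIVE**, BC7-LS 8/8 CLEAN, carrier read-back
symbol by symbol (the `Nat.card (selmerGroup (W.quadraticTwist d) 2)` idiom sidesteps T7/T14; on the
admissible locus `d ≡ 1 (mod 8)` `oddBranchTameValue` is exactly Birch's `Σ χ_d(a)[a/|d|]⁻` — for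
`d ≡ 5 (mod 8)` the even-`a` terms would need the Kronecker symbol, and T-G/T-G⁰ are stated only over
`DescAdmissible`; «`0 < W.Δ` possibly unnecessary for T-A/T-A′/T-A⁵/T-A⁵′»). REF2-PLACEMENT-v5 §1:
DESC-F/F′/F″/F⁵/V = IN PRINT AS MATHEMATICS (Kramer 1981 Prop. 6; Yu 2017 MRL 24 Lemma 26 and proof of
Thm 28; Brau–Jones/BPT 2021 Lemma 1.1 (ii), Rem. 1.2, Thm 3.7, Ex. 7; Mazur–Rubin 2010 Lemmas 2.10/2.11),
DESC-G⁰ OPEN-IN-PRINT (Zhai 2016 p.3 / Thm 1.7, Zhai 2021 Rem. 1.4 exclude imaginary twists of `Δ > 0`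
curves; Kriz–Li 2019 Thm 5.1 conditional); beyond-print theorem: no.

## The planner's sketch docstring (v2.1, verbatim)

HONEST FRAMING. Statements only (defs with bodies, nothing asserted). For `E/ℚ` with `Δ_E > 0` and
`E(ℚ)[2] = 0` the mod-2 Selmer structure `Sel₂(E) ⊂ H¹(ℚ, E[2])` has a relaxed/strict-at-∞ gap of
exactly one (`dim S¹ = dim S⁰ + 1`, Poitou–Tate / Kramer 1981 Prop. 6 `i_∞ = 1`), so the image
`loc_∞(S¹) ⊂ H¹(ℝ, E[2]) ≅ E[2]` is a LINE `T*(E)`; parity (Monsky 1996) forces `T*(E) ∈ {T_least, T_largest}`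
(never `T_middle`), and `ε(E) := +1` if `T*(E) = T_least` (the Kummer line: `Sel₂(E) = S¹`, `loc_∞` onto
`E(ℝ)/2E(ℝ)`), `ε(E) := −1` if `T*(E) = T_largest` (`Sel₂(E) = S⁰`). For a *descent-admissible* `d < 0`
(`d ≡ 1 (8)`, squarefree, every prime `q ∣ d` of good reduction with `a_q(E)` odd, `d` a square mod every
odd bad prime) ALL finite local conditions of `E` and `E^{(d)}` in `H¹(ℚ, E[2])` coincide and the Kummer
line at `∞` swaps `least ↔ largest`, hence THEOREM A: `#Sel₂(E^{(d)}) = #Sel₂(E) · 2^{−ε(E)}`, independent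
of `d`. The typed items below state THEOREM A and its corollaries over tree declarations ONLY through
Selmer CARDINALITIES of `W` and of its twists (no `S⁰/S¹` carrier is needed): `AdmissibleTwistSelmerShiftAtTwo`
(T-A), `AdmissibleTwistSelmerLevelAtTwo` (T-A′, `d`-independence), `EggTwistLawAtTwo` (T-C, rank one: the
real component of the generator decides every admissible twist), `StrictShaPropagationAtTwo` (T-V, rank 0 with
`#Sel₂ = 4`, the X5 habitat: dichotomy `#Sel₂(E^{(d)}) ∈ {2, 8}`), and the BSD₂-shadow on the admissible locus
`AdmissibleOddBranchFloorAtTwo` (T-G: the odd-branch tame value `Σ_a χ_d(a)[a/|d|]⁻_f` has 2-adic valuation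
at its floor iff `(#Sel₂(E), ε(E)) = (2, +1)`), whose symbol↔`L(E^{(d)},1)` half is Birch's formula and whose
`L ↔ Sel₂` half is the 2-part of BSD for the rank-0, `Sel₂`-trivial twist. Census (Cremona `N < 2·10⁴`,
MEMO-desc §10): T-A 808/808 twists, T-A′ 50/50 curves with two admissible twists, T-C 440/440, ε via twists =
ε via generators 714/714; T-V needs `-data` (X5 classes have `49N > 5·10⁵`).
-/

namespace Summit.BirchSwinnertonDyer.Rank1Residual.F1Sign2

open scoped Classical MatrixGroups ModularForm
open CongruenceSubgroup WeierstrassCurve Literature.NumberTheory.EllipticCurves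
open Literature.NumberTheory.EllipticCurves.Greenberg1999 Literature.NumberTheory.EllipticCurves.ModularForms
open Literature.NumberTheory.EllipticCurves.Rank1Residual

set_option autoImplicit false

noncomputable section

/-- `E(ℚ)[2] = 0`: the `2`-division cubic has no rational root (tree predicate `HasRationalTwoTorsionX`). -/
def NoRationalTwoTorsion (W : WeierstrassCurve ℚ) : Prop := ∀ x : ℚ, ¬ HasRationalTwoTorsionX W x

/-- **Descent-admissible twist parameter** for a globally minimal `W/ℚ`: `d < 0`, squarefree, `d ≡ 1 (mod 8)`
(so `2` splits in `ℚ(√d)` and the local condition at `2` is unchanged), every prime `q ∣ d` is a prime of good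
reduction with `a_q(W)` odd (`⇔ H¹(ℚ_q, W[2]) = 0`, so the condition at `q` is unchanged), and `d` is a square
modulo every odd prime of bad reduction (`W^{(d)} ≅ W` over `ℚ_ℓ`). Such `d` have `χ_d(−N) = −1` (Heegner sign
flip) and exist in infinite number (Chebotarev). -/
def DescAdmissible (W : WeierstrassCurve ℚ) [W.IsGloballyMinimal] (d : ℤ) : Prop :=
  d < 0 ∧ Squarefree d ∧ d % 8 = 1 ∧
    (∀ q : ℕ, q.Prime → (q : ℤ) ∣ d →
      (∀ _h : Fact q.Prime, W.HasGoodReductionAtPrime q) ∧ Odd (W.frobeniusTrace q)) ∧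
    (∀ ℓ : ℕ, ℓ.Prime → ℓ ≠ 2 → (∀ _h : Fact ℓ.Prime, ¬ W.HasGoodReductionAtPrime ℓ) → jacobiSym d ℓ = 1)

/-- `#Sel₂` of the quadratic twist `W^{(d)}` (tree `quadraticTwist`, `selmerGroup`). -/
def twistSelmerTwoCard (W : WeierstrassCurve ℚ) (d : ℤ) : ℕ :=
  Nat.card (WeierstrassCurve.selmerGroup (W.quadraticTwist (d : ℚ)) 2)

/-- `#Sel₂(W)`. -/
def selmerTwoCard (W : WeierstrassCurve ℚ) : ℕ := Nat.card (WeierstrassCurve.selmerGroup W 2)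

/-- **T-A `AdmissibleTwistSelmerShiftAtTwo` (THEOREM A, support-grade; census 808/808).** For `Δ_W > 0`,
`E(ℚ)[2] = 0` and a descent-admissible `d`: `#Sel₂(W^{(d)})` is `#Sel₂(W)/2` or `2·#Sel₂(W)` — the shift is
`±1` in dimension, never `0`, never `≥ 2`. [cite: Kramer1981, Prop. 6; Monsky1996, Thm. 1.5; MazurRubin2010, §3]
LANDING NOTE (-ty g11, 2026-08-28): PROVED in the kernel with NO hypothesis left — `Summit.BirchSwinnertonDyer.BirchSwinnertonDyer.Theorems.GenusKolyArch.admissibleTwistSelmerShiftAtTwo_holds`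
(`Theorems/GenusKolyvaginAtTwoGenusPrimitiveSupplyAtTwoArchimedeanRowsHold.lean`, bsd-line-gk2-p4 g12, p654350 ACCEPTED; PT, Tate χ, Kramer's congruence for the framed
canonical identification are tree theorems; std axioms); users' `(h : …)` binders are fed that theorem.  This `def` stays as the binder name (append-only). -/
def AdmissibleTwistSelmerShiftAtTwo : Prop :=
  ∀ (W : WeierstrassCurve ℚ) [W.IsElliptic] [W.IsGloballyMinimal], 0 < W.Δ → NoRationalTwoTorsion W →
    ∀ d : ℤ, DescAdmissible W d →
      2 * twistSelmerTwoCard W d = selmerTwoCard W ∨ twistSelmerTwoCard W d = 2 * selmerTwoCard W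

/-- **T-A′ `AdmissibleTwistSelmerLevelAtTwo` (THEOREM A, `d`-independence = well-definedness of `ε(W)`;
census 50/50 curves with two admissible twists in range).** [cite: Kramer1981, Prop. 6]
LANDING NOTE (-ty g11, 2026-08-28): PROVED in the kernel with NO hypothesis left — `Summit.BirchSwinnertonDyer.BirchSwinnertonDyer.Theorems.GenusKolyArch.admissibleTwistSelmerLevelAtTwo_holds`
(`Theorems/GenusKolyvaginAtTwoGenusPrimitiveSupplyAtTwoArchimedeanRowsHold.lean`, bsd-line-gk2-p4 g12, p654350 ACCEPTED; PT, Tate χ, Kramer's congruence for the framed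
canonical identification are tree theorems; std axioms); users' `(h : …)` binders are fed that theorem.  This `def` stays as the binder name (append-only). -/
def AdmissibleTwistSelmerLevelAtTwo : Prop :=
  ∀ (W : WeierstrassCurve ℚ) [W.IsElliptic] [W.IsGloballyMinimal], 0 < W.Δ → NoRationalTwoTorsion W →
    ∀ d d' : ℤ, DescAdmissible W d → DescAdmissible W d' → twistSelmerTwoCard W d = twistSelmerTwoCard W d'

/-- The abscissa `x` lies on the EGG (the non-identity real component): some real root of the `2`-division
cubic `4e³ + b₂e² + 2b₄e + b₆` exceeds `x` (on the identity component `x ≥ e₁`, the largest root). -/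
def OnEgg (W : WeierstrassCurve ℚ) (x : ℚ) : Prop :=
  ∃ e : ℝ, 4 * e ^ 3 + (W.b₂ : ℝ) * e ^ 2 + 2 * (W.b₄ : ℝ) * e + (W.b₆ : ℝ) = 0 ∧ (x : ℝ) < e

/-- `E(ℚ)` meets the egg: some rational affine point has abscissa on the egg
(`⇔ E(ℚ) ⊄ E⁰(ℝ) ⇔ E(ℚ) → E(ℝ)/2E(ℝ)` onto). -/
def MeetsEgg (W : WeierstrassCurve ℚ) : Prop := ∃ x y : ℚ, W.toAffine.Equation x y ∧ OnEgg W x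

/-- `Ш(W)[2] = 0`. -/
def ShaTwoTrivial (W : WeierstrassCurve ℚ) : Prop := ∀ c ∈ WeierstrassCurve.sha W, 2 • c = 0 → c = 0

/-- **T-C `EggTwistLawAtTwo` (corollary of THEOREM A; census 375/375 + 65/65).** Rank one, `Ш[2] = 0`,
`Δ > 0`, `E(ℚ)[2] = 0`: if `E(ℚ)` meets the egg (`ε = +1`) every admissible twist has TRIVIAL `Sel₂`
(rank 0 and `Ш[2] = 0`); if `E(ℚ) ⊂ E⁰(ℝ)` (`ε = −1`) every admissible twist has `#Sel₂ = 4`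
(BSD: rank 2, or rank 0 with `Ш[2] = (ℤ/2)²` — both occur: 43 / 22). [cite: Kramer1981, Prop. 6]
LANDING NOTE (-ty g11, 2026-08-28): PROVED in the kernel with NO hypothesis left — `Summit.BirchSwinnertonDyer.BirchSwinnertonDyer.Theorems.GenusKolyArch.eggTwistLawAtTwo_holds`
(`Theorems/GenusKolyvaginAtTwoGenusPrimitiveSupplyAtTwoArchimedeanRowsHold.lean`, bsd-line-gk2-p4 g12, p654350 ACCEPTED; PT, Tate χ, Kramer's congruence for the framed
canonical identification are tree theorems; std axioms); users' `(h : …)` binders are fed that theorem.  This `def` stays as the binder name (append-only). -/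
def EggTwistLawAtTwo : Prop :=
  ∀ (W : WeierstrassCurve ℚ) [W.IsElliptic] [W.IsGloballyMinimal], 0 < W.Δ → NoRationalTwoTorsion W →
    W.mordellWeilRank = 1 → ShaTwoTrivial W → ∀ d : ℤ, DescAdmissible W d →
      (MeetsEgg W → twistSelmerTwoCard W d = 1) ∧ (¬ MeetsEgg W → twistSelmerTwoCard W d = 4)

/-- **T-V `StrictShaPropagationAtTwo` (THEOREM A on the X5 habitat; the VISIBILITY dichotomy in cardinal
form).** Rank 0, `#Sel₂(W) = 4` (`Ш(W)[2] = (ℤ/2)²`), `Δ > 0`, `E(ℚ)[2] = 0`: every admissible twist has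
`#Sel₂ = 2` (`ε = +1`: the strict class `c₀ ∈ Ш(W)[2]` IS the Kummer class of `E^{(d)}(ℚ)` — visible in
`(E × E^{(d)})/Δ E[2]` for every admissible `d` — and `Ш(E^{(d)})[2] = 0`) or every admissible twist has
`#Sel₂ = 8` (`ε = −1`: `Ш(W)[2] ↪ Ш(W^{(d)})[2]`, nothing of `Ш(W)[2]` is visible in any admissible twist).
Needs `-data` (ask D-desc-8): no X5 class has `49 N < 5·10⁵`. [cite: Kramer1981, Prop. 6; CremonaMazur2000, §3 (visibility in E × E^{(d)})]
LANDING NOTE (-ty g11, 2026-08-28): PROVED in the kernel with NO hypothesis left — `Summit.BirchSwinnertonDyer.BirchSwinnertonDyer.Theorems.GenusKolyArch.strictShaPropagationAtTwo_holds`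
(`Theorems/GenusKolyvaginAtTwoGenusPrimitiveSupplyAtTwoArchimedeanRowsHold.lean`, bsd-line-gk2-p4 g12, p654350 ACCEPTED; PT, Tate χ, Kramer's congruence for the framed
canonical identification are tree theorems; std axioms); users' `(h : …)` binders are fed that theorem.  This `def` stays as the binder name (append-only). -/
def StrictShaPropagationAtTwo : Prop :=
  ∀ (W : WeierstrassCurve ℚ) [W.IsElliptic] [W.IsGloballyMinimal], 0 < W.Δ → NoRationalTwoTorsion W →
    W.mordellWeilRank = 0 → selmerTwoCard W = 4 →
      (∀ d : ℤ, DescAdmissible W d → twistSelmerTwoCard W d = 2) ∨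
      (∀ d : ℤ, DescAdmissible W d → twistSelmerTwoCard W d = 8)

/-- The odd-branch TAME value at the admissible character `χ_d`: `Θ⁻(f, d) := Σ_{0<a<|d|} (d/a)·[a/|d|]⁻_f`
(tree `ratMinusSymbol`; by Birch's formula `= ± 2^{e₀} · √|d| · L(E^{(d)},1)/Ω⁻`-type quantity). -/
def oddBranchTameValue {N : ℕ} (f : CuspForm (Gamma0 N) 2) (d : ℤ) : ℚ :=
  ∑ a ∈ Finset.range d.natAbs, (jacobiSym d a : ℚ) * ratMinusSymbol f ((a : ℚ) / (d.natAbs : ℚ))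

/-- **T-G `AdmissibleOddBranchFloorAtTwo` (BSD₂-shadow on the admissible locus; the analytic face of `ε`).**
For `W` good at `2`, `Δ > 0`, `E(ℚ)[2] = 0`, newform `f`, admissible `d`: the `2`-adic valuation of the odd-branch
tame value is NON-ZERO and sits at the floor `e + v₂(∏_p c_p(W))` (`e` ONE universal normalising constant of
the tree symbol `[·]⁻_f` — `c_∞(E^{(d)}) = 2`, odd torsion and twist-scaling `u = 1` for `d ≡ 1 (4)` make it
uniform; the non-vanishing guard removes the junk value `v₂(0) = 0`) iff the twist `E^{(d)}` has trivial `Sel₂`,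
i.e. (by T-A/T-A′) iff `#Sel₂(W) = 2` and `ε(W) = +1`. Symbol ↔ `L(E^{(d)},1)`: Birch; `c_p(E^{(d)}) = c_p(E)` on the admissible
locus (type `I₀*` with `c_q = 1` at `q ∣ d` since `a_q` odd); `L ↔ Sel₂`: the 2-part of BSD for the rank-0,
`Sel₂`-trivial twist (known in Kriz–Li 2019 / Zhai 2016 / Cai–Li–Zhai 2020 families, open in general).
Census: non-circular half = ε via generators vs `Ш_an, r` of twists, 714/714. [cite: KrizLi2019, Thm. 5.1; Zhai2016, Thm. 1.1] -/
def AdmissibleOddBranchFloorAtTwo : Prop :=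
  ∃ e : ℤ, ∀ (W : WeierstrassCurve ℚ) [W.IsElliptic] [W.IsGloballyMinimal], 0 < W.Δ → NoRationalTwoTorsion W →
    (∀ _h : Fact (Nat.Prime 2), W.HasGoodReductionAtPrime 2) →
    ∀ ⦃N : ℕ⦄ [NeZero N] (f : CuspForm (Gamma0 N) 2), IsNewformOf W f →
      ∀ d : ℤ, DescAdmissible W d →
        ((oddBranchTameValue f d ≠ 0 ∧
            padicValRat 2 (oddBranchTameValue f d) = e + padicValNat 2 (WeierstrassCurve.tamagawaProduct W)) ↔
          twistSelmerTwoCard W d = 1)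

/-- **T-G⁰ (DESC-G⁰, conjecture; `e = 0` pinned, no reduction hypothesis at 2).** With the tree
normalisation `[r]⁻_f = im(minusSymbol)/Ω⁻_f`, the census gives `Ω(W^{(d)})·√|d| = Ω⁻_f` exactly for every
admissible `d` (1 317/1 317 twists, all reduction types at 2; Pal 2012 for `d ≡ 1 (mod 4)`), so
`Θ⁻(f,d) = L(W^{(d)},1)/Ω(W^{(d)})` and the floor exponent is `e = 0`: the odd twisted symbol sum has
EXACTLY the 2-adic valuation of the Tamagawa product of `W` iff the admissible twist has trivial `Sel₂`.
Census (Cremona `Ш_an`): 604/604 `Sel₂(W^{(d)}) = 0` twists have `v₂(Θ⁻) = v₂(∏c_p(W))`; 41/41 rank-0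
twists with `Ш[2] ≠ 0` have excess `∈ {2,4,6}`; 672 positive-rank twists have `Θ⁻ = 0`; non-circular
support via THEOREM A: generator of `W` on the egg ⇒ every admissible twist has `r_an = 0`, `Ш_an` odd (604/604). -/
def AdmissibleOddBranchExactAtTwo : Prop :=
  ∀ (W : WeierstrassCurve ℚ) [W.IsElliptic] [W.IsGloballyMinimal], 0 < W.Δ → NoRationalTwoTorsion W →
    ∀ ⦃N : ℕ⦄ [NeZero N] (f : CuspForm (Gamma0 N) 2), IsNewformOf W f →
      ∀ d : ℤ, DescAdmissible W d →
        ((oddBranchTameValue f d ≠ 0 ∧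
            padicValRat 2 (oddBranchTameValue f d) = padicValNat 2 (WeierstrassCurve.tamagawaProduct W)) ↔
          twistSelmerTwoCard W d = 1)

/-- T-G⁰ ⇒ T-G (take `e = 0`; T-G additionally restricts to good reduction at 2). -/
theorem admissibleOddBranchFloor_of_exact : AdmissibleOddBranchExactAtTwo → AdmissibleOddBranchFloorAtTwo := by
  intro h
  refine ⟨0, ?_⟩
  intro W _ _ hΔ ht _ N _ f hf d hd
  simpa using h W hΔ ht f hf d hd

/-- Unramified-at-2 admissibility (`d ≡ 5 (mod 8)`), only for `W` with GOOD reduction at 2: the local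
conditions at 2 of `W` and `W^{(d)}` then still coincide (Mazur's norm lemma for good reduction in an
unramified extension; Kramer 1981 Prop. 3), all other clauses as in `DescAdmissible`. -/
def DescAdmissibleUnram (W : WeierstrassCurve ℚ) [W.IsGloballyMinimal] (d : ℤ) : Prop :=
  d < 0 ∧ Squarefree d ∧ d % 8 = 5 ∧ (∀ _h : Fact (Nat.Prime 2), W.HasGoodReductionAtPrime 2) ∧
    (∀ q : ℕ, q.Prime → (q : ℤ) ∣ d →
      (∀ _h : Fact q.Prime, W.HasGoodReductionAtPrime q) ∧ Odd (W.frobeniusTrace q)) ∧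
    (∀ ℓ : ℕ, ℓ.Prime → ℓ ≠ 2 → (∀ _h : Fact ℓ.Prime, ¬ W.HasGoodReductionAtPrime ℓ) → jacobiSym d ℓ = 1)

/-- **T-A⁵ (DESC-F⁵, support-grade extension of THEOREM A to `d ≡ 5 (mod 8)` for good reduction at 2).**
Census: 505/505 such twists shift by exactly one 2-power; 79/79 curves having admissible twists of both
residue classes mod 8 show the same sign.
LANDING NOTE (-ty g11, 2026-08-28): PROVED in the kernel with NO hypothesis left — `Summit.BirchSwinnertonDyer.BirchSwinnertonDyer.Theorems.GenusKolyArch.unramifiedTwistSelmerShiftAtTwo_holds`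
(`Theorems/GenusKolyvaginAtTwoGenusPrimitiveSupplyAtTwoArchimedeanUnramifiedRowsHold.lean`, bsd-line-gk2-p5 g12, p658339 ACCEPTED; Kramer 1981 Prop. 6 with
Prop. 3 / Mazur 1972 Cor. 4.4 at 2, std axioms; `NoRationalTwoTorsion` unused there); users' `(h : …)` binders are fed that theorem.  This `def` stays as
the binder name (append-only). -/
def UnramifiedTwistSelmerShiftAtTwo : Prop :=
  ∀ (W : WeierstrassCurve ℚ) [W.IsElliptic] [W.IsGloballyMinimal], 0 < W.Δ → NoRationalTwoTorsion W →
    ∀ d : ℤ, DescAdmissibleUnram W d →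
      2 * twistSelmerTwoCard W d = selmerTwoCard W ∨ twistSelmerTwoCard W d = 2 * selmerTwoCard W

/-- **T-A⁵′ (level across residue classes).** An unramified-admissible and a split-admissible twist of the
same curve have the same `#Sel₂` (79/79).
LANDING NOTE (-ty g11, 2026-08-28): PROVED in the kernel with NO hypothesis left — `Summit.BirchSwinnertonDyer.BirchSwinnertonDyer.Theorems.GenusKolyArch.mixedTwistSelmerLevelAtTwo_holds`
(`Theorems/GenusKolyvaginAtTwoGenusPrimitiveSupplyAtTwoArchimedeanUnramifiedRowsHold.lean`, bsd-line-gk2-p5 g12, p658339 ACCEPTED; MR 2010 Cor. 3.4 (i) with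
T = {∞} and Lemma 2.10 (v) at v = 2, std axioms); users' `(h : …)` binders are fed that theorem.  This `def` stays as the binder name (append-only). -/
def MixedTwistSelmerLevelAtTwo : Prop :=
  ∀ (W : WeierstrassCurve ℚ) [W.IsElliptic] [W.IsGloballyMinimal], 0 < W.Δ → NoRationalTwoTorsion W →
    ∀ d d' : ℤ, DescAdmissible W d → DescAdmissibleUnram W d' → twistSelmerTwoCard W d = twistSelmerTwoCard W d'

/-! ### Glue (proved): T-C's two branches are T-A + T-A′ bookkeeping once `ε` is read off the egg; here only the
purely logical link "level law ⇒ the X5 dichotomy is exhaustive given the shift law" is recorded. -/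

/-- From the shift law and the level law: on the X5 habitat (`#Sel₂(W) = 4`) the admissible twists all have
`#Sel₂ = 2` or all have `#Sel₂ = 8`. -/
theorem strictShaPropagation_of_shift_level
    (hA : AdmissibleTwistSelmerShiftAtTwo) (hL : AdmissibleTwistSelmerLevelAtTwo) :
    StrictShaPropagationAtTwo := by
  intro W _ _ hΔ ht _hr h4
  by_cases hex : ∃ d : ℤ, DescAdmissible W d
  · obtain ⟨d₀, hd₀⟩ := hex
    rcases hA W hΔ ht d₀ hd₀ with h | h
    · left
      intro d hd
      rw [hL W hΔ ht d d₀ hd hd₀]; omega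
    · right
      intro d hd
      rw [hL W hΔ ht d d₀ hd hd₀]; omega
  · left
    intro d hd
    exact absurd ⟨d, hd⟩ hex

/-! ### Norm-clean discriminants (appended by the typer seat `-ty` g2 from -desc g5's `HOME/MEMO-desc-data/Sketch-v5b.lean`
4f047dbdad7347c7, bodies VERBATIM; asked for by -an's D-desc-an-2 / AN-10H♯ — MEMO-desc §13.3 row NC, §13.6; REF2 v12 §0:
«NC = DEFINITION + 2 proved sufficiency lemmas (Kramer Props 1–3, 5–6)») -/

/-- **`KramerNormCleanSuff W d`** (for `-an`, D-desc-an-2): an elementary SUFFICIENT condition for the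
vanishing of every finite local norm index `i_v = dim_𝔽₂ W(ℚ_v)/N W(K_w)` of Kramer 1981 for `K = ℚ(√d)`:
`d` squarefree and odd with (i) at `2`: `d ≡ 1 (mod 8)` (2 splits) or `d ≡ 5 (mod 8)` and `W` good at `2`
(unramified + good ⇒ `i₂ = 0`, Mazur / Kramer–Tunnell Lemma); (ii) every odd prime `q ∣ d` (ramified) is
good with `a_q` odd (`W(ℚ_q)[2] = W̃(𝔽_q)[2] = 0`, Kramer Prop. 3); (iii) every odd bad prime `ℓ ∤ d` either
splits (`(d/ℓ) = 1`) or is multiplicative with `v_ℓ(Δ)` odd and inert (Kramer Props. 1, 2(a): index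
`[v_ℓ(Δ) even]`).  The archimedean index (`[Δ > 0]` for `d < 0`, `0` for `d > 0`) is NOT part of the
condition.  `DescAdmissible W d` and `DescAdmissibleUnram W d` both imply it. [cite: Kramer1981, Props. 1–3, 5] -/
def KramerNormCleanSuff (W : WeierstrassCurve ℚ) [W.IsGloballyMinimal] (d : ℤ) : Prop :=
  Squarefree d ∧ (d % 8 = 1 ∨ (d % 8 = 5 ∧ ∀ _h : Fact (Nat.Prime 2), W.HasGoodReductionAtPrime 2)) ∧
    (∀ q : ℕ, q.Prime → (q : ℤ) ∣ d →
      (∀ _h : Fact q.Prime, W.HasGoodReductionAtPrime q) ∧ Odd (W.frobeniusTrace q)) ∧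
    (∀ ℓ : ℕ, ℓ.Prime → ℓ ≠ 2 → (∀ _h : Fact ℓ.Prime, ¬ W.HasGoodReductionAtPrime ℓ) →
      jacobiSym d ℓ = 1 ∨
        ((∀ _h : Fact ℓ.Prime, W.HasMultiplicativeReductionAtPrime ℓ) ∧ Odd (padicValRat ℓ W.Δ) ∧
          jacobiSym d ℓ = -1))

/-- A descent-admissible discriminant is norm-clean (definitional). -/
theorem descAdmissible_normClean (W : WeierstrassCurve ℚ) [W.IsGloballyMinimal] (d : ℤ)
    (h : DescAdmissible W d) : KramerNormCleanSuff W d :=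
  ⟨h.2.1, Or.inl h.2.2.1, h.2.2.2.1, fun ℓ hℓ h2 hbad => Or.inl (h.2.2.2.2 ℓ hℓ h2 hbad)⟩

/-- An unramified-at-2 descent-admissible discriminant is norm-clean (definitional). -/
theorem descAdmissibleUnram_normClean (W : WeierstrassCurve ℚ) [W.IsGloballyMinimal] (d : ℤ)
    (h : DescAdmissibleUnram W d) : KramerNormCleanSuff W d :=
  ⟨h.2.1, Or.inr ⟨h.2.2.1, h.2.2.2.1⟩, h.2.2.2.2.1, fun ℓ hℓ h2 hbad => Or.inl (h.2.2.2.2.2 ℓ hℓ h2 hbad)⟩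

end

end Summit.BirchSwinnertonDyer.Rank1Residual.F1Sign2
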